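import Literature.MathematicalPhysics.QuantumFieldTheory.Balaban1983to89.Node00.N24ItemsStage13AtThm1CCMWOfStepRSignFreeAllTorusSepCoPH

/-!
# DAG node N11 ∕ NODE 00 door — K0⁷'s DOOR PROVISOS `Provisos₁₃SepCoPH` AT THE cR-LETTERED MEMBERS OF K1's WITNESS NUMERICS, FROM EXACTLY THE K0-SIDE INPUTS DISPLAYED AT
# `θ₁₅ᶜᶜᴹᵂ(j; γ)` (dag-n24-c Part 14 §0c: (8), the R (9)-step sentence, the SIGN-FREE windowed β-box OF `betaOfRecord₁₃ F N θ₁₅ᶜᶜᴹᵂ` with its two letters, the six signs),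
# for every regularity letter `0 < c ≤ 8` — the K0 side of dag-n11-d's LOCATED-cR re-pin is FREE (kernel), nothing minted

HEADER — WORK-UNIT METADATA.  Cell `pub-ymgap`, YM-PLAN Track A (HUMAN RULING D-0062 ∕ D-0149 width seats), seat `pub-ymgap-dag-n11-w3` (g4; WIDTH SEAT 3∕4 on NODE n11 [B14]),
route `BalabanUVNodes` rev 27, deciding item K1⁸ `StabilityBRunRowsAtRecordR13SepCoPH` = stmt-QuantumFields-26907 (dag-lead KEY MAP I.31754; helper lane `--kind proof --supports 26907
--as helper`, count-neutral).  Sequel of this seat's `…N11SupplyChainAtCRLetteredNumerics` (N11's token on the K0-rows road at the cR-lettered member, every θ-level letter of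
the road inhabited; ★ the `c`-blind rows `betaOfRecord₁₃ ∕ gOfRecord₁₃ ∕ PartCompat₁₃ ∕ ν ∕ τ9` by `rfl`).  Over node00-def-K0a's `Node00/Record13SepCoPLiveSelector` (★★★
`provisos₁₃SepCoP_theta13LiveOfNumerics_of_bgSepCoP` — GENERIC in the numerics `n`), `Node00/Record13BgRow` (`Stage13Params.bg_numerics_of_letters`), dag-n21-c's Eʷ ∕ allTorus
`Node00/Record13SepCoPInhabitedOfThm1CCMWGaugeRAllTorus` (★★ `Stage13Params.bgAtDatumCoP_of_thm1RegSepCoP7M_of_thm1GaugeR_allTorus` — GENERIC in `θ`; its §3 is the `θ₁₅ᶜᶜᴹᵂ` instance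
this file re-runs at the member), A2ʷ `Node00/Record13LettersOfThm1CCMW` (the `c`-blind letters `hg ∕ hC1`, re-read by `rfl`), Dʷ `Node00/Record13SignFreeComparabilityOfBetaBox`
(`hcompBoth_theta13OfThm1CCMW_of_betaBoxSignFree`), B′ `variationalThm1GaugeRegSepCoP7MR_of_gauge9TopStepR`, and dag-n24-c Part 14 `Node00/N24ItemsStage13AtThm1CCMWOfStepRSignFreeAllTorusSepCoPH`
(§0c ★ `N24_provisos₁₃SepCoPH_door_theta13OfThm1CCMW_of_gauge9TopStepR_of_betaBoxSignFree_allTorus` — the door at `c = 1`, whose hypothesis list this file's ★★★★ COPIES VERBATIM).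
[III] = [Balaban1988Convergent], [15] = [Balaban1985Variational], [6] = [Balaban1985RegularSpaces], [I] = [Balaban1987RG1], [IV] = [Balaban1989LargeFieldI], [LF-II] = [Balaban1989LargeFieldII].

WHY THIS FILE (dag-n11-d g14 LOCATED-cR I.30035; this seat's LOCATED-ROADMAP-cR I.32222 and CLAIM-1).  LOCATED-cR asked the definers to re-pin the located regularity constant
`cR := 1` of every witness of record to `cR ≥ 2` (print (2.10): O(L²)), because N11's K0-rows road carries `hcR : 2 ≤ θ.s2.cR`.  CLAIM-1 showed the N11 side costs nothing
(every θ-level letter of the road inhabited at the member `n_c := {θ₁₅ᶜᶜᴹᵂ's numerics with s2.cR := c}`, `c ≥ 2`, and the `c`-blind rows are `rfl`).  THIS FILE settles the K0 side: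
of the door's displayed K0-side inputs NONE reads `c` — (8) `VariationalThm1RegSepCoP7M F N B₃ a₀ a₁` and the R (9)-step sentence are θ-free, the β-box is read at
`betaOfRecord₁₃ F N θ₁₅ᶜᶜᴹᵂ` = the member's β of record (`rfl`), the window and `PartCompat₁₃` guards of row `bg` are the member's (`rfl`) — and every cR-READING LETTER the
generic row-`bg` engine consumes ((hnum) `0 < c·ε_m ≤ a₁`, `B₃·c·ε_m ≤ εreg = a₀`; (hBα) `B₃·c·ε_m ≤ (1−β)·α₀(g_m)`; the gauge radius letters (htI) `B₃′·c·ε_m ≤ c_B·α₀(g_m)`, (htMS)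
`B₃′·c·ε_m ≤ B·C·M_r·α₀(g_m)`; (hcomp) ∧ (hcompRev) `c·ε_m ≤ 2·c·ε_{m±1}`) HOLDS AT THE MEMBER WITH `A₀ = A₀ᶜᶜ¹` UNCHANGED for `0 < c ≤ 8`, by the factor-8 slack node00-def-K0a ∕
dag-n21-c built into `A₀ᶜ := A₀∕8` (`A₀ᶜᶜ¹ ≤ A₀ᶜ = A₀∕8 ≤ a₁∕8`, `B₃·A₀ᶜᶜ¹ ≤ a₀∕8`, `B₃·A₀ᶜᶜ¹ ≤ 1∕16`, `B₃′·A₀ᶜᶜ¹ ≤ 1∕192`) and the homogeneity of (hcomp) in `cR`.  Hence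
★★★★: K0⁷'s door provisos at the history-blind door over the cured member — SAME STATEMENT SHAPE, SAME HYPOTHESES as Part 14 §0c at `θ₁₅ᶜᶜᴹᵂ` — for every `0 < c ≤ 8`.
So the re-pin of LOCATED-cR needs NO definers' file and NO K0 re-work: whatever closes K0⁷'s V19 stubs at `θ₁₅ᶜᶜᴹ(ᵂ)` ((8), the (9)-step, the β-box AT `betaOfRecord₁₃ θ₁₅ᶜᶜᴹᵂ`) closes
the door at the `c := 2` member BY NAME, where N11's K0-rows road is non-vacuous (CLAIM-1).

WHAT THIS FILE PROVES (0 `def`, 0 `sorry`, standard axioms; `θ` any Stage-13 parameter EQUAL to the member at K0b's residual pins, `hθ`; `c`, `γ` letters).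
§1 the cR-reading letters at the member: `hnum_ccmwCR` (`0 < c ≤ 8`) · `εreg_le_ccmwCR` · `lfOfRecord₁₂_ccmwCR` (`rfl`) · `hpq_ccmwCR` · `hg_ccmwCR` ∕ `hC1_ccmwCR` (`c`-blind, A2ʷ's by `rfl`) ·
   `hBα_ccmwCR` (`0 ≤ c ≤ 12`) · `htI_ccmwCR` ∕ `htMS_ccmwCR` (`0 ≤ c ≤ 192`) · `hcomp_ccmwCR_of_ccmw` ∕ `hcompRev_ccmwCR_of_ccmw` (the member's (hcomp)∕(hcompRev) FROM `θ₁₅ᶜᶜᴹᵂ`'s, `0 ≤ c`) ·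
   ★ `hcompBoth_ccmwCR_of_betaBoxSignFree` (both from the SIGN-FREE windowed β-box of `betaOfRecord₁₃ F N θ₁₅ᶜᶜᴹᵂ` — Dʷ ∘ rescaling).
§2 ★★★ `bgSepCoPAt_ccmwCR_of_thm1GaugeR_of_hcomp_allTorus` — the (7)-guarded separated row P11 at the Co carrier AT THE MEMBER from `0 < γ ≤ ½`, (8), the R gauge sentence and
   (hcomp) ∧ (hcompRev), on every family (Eʷ-allTorus §3 re-run at the member through the θ-generic engine; statement = Eʷ's with `θ₁₅ᶜᶜᴹᵂ ↦ θ`).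
§3 ★★★ `provisos₁₃SepCoP_ccmwCR_of_thm1GaugeR_of_hcomp_allTorus` (K0a's generic socket ∘ §2) · ★★★★ `provisos₁₃SepCoPH_door_ccmwCR_of_gauge9TopStepR_of_betaBoxSignFree_allTorus` —
   `(Stage13HParams.ofHistoryBlind F N ⟨θ, ZrOfRecord₁₃ F N θ⟩).Provisos₁₃SepCoPH F N` from Part 14 §0c's HYPOTHESES VERBATIM (`0 < γ ≤ ½`, signs, (8), `c₁₅ ≤ L^j`, the (9)-step
   `Gauge9RegSepTopStepR … (F.L ^ j) c₁₅ …`, `BetaLowerH bₗ γ ∕ BetaUpperH β′ γ (betaOfRecord₁₃ F N θ₁₅ᶜᶜᴹᵂ)`, `−bₗ·γ² ≤ 3`, `β′·γ² ≤ ¾`) plus ONLY `0 < c ≤ 8`.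

HONEST FRAMING ∕ A6.  Helper lane, count-neutral KERNEL BOOKKEEPING (elementary real arithmetic on displayed numerals + applications BY NAME of the definers' θ-generic engines);
nothing of Bałaban ([III] ∕ [15] ∕ [6] ∕ [I]) is asserted: (8), the (9)-step sentence and the β-box are DISPLAYED HYPOTHESES exactly as in Part 14 (K0⁷'s stub territory — NOT proved
here for any family); this is a REDUCTION at a re-lettered member, NOT a discharge and NOT a re-pin of any witness of record (no `def`; at `c := 1` the member IS `θ₁₅ᶜᶜᴹᵂ` by
`rfl`, CLAIM-1 `theta13LiveOfNumerics_ccmwCR_one`).  The numerals are node00-def-K0a ∕ dag-n21-c's displayed choices; `0 < c ≤ 8` is the slack their `A₀ᶜ = A₀∕8` leaves (print's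
O(L²) would need `A₀` re-scaled — said, not done).  K0⁷ NOT closed; N11 NOT discharged; K1⁸ NOT closed, no stub touched; counts unmoved (typed 28∕28 · discharged 5∕27 · A 5∕28).
One finite `𝕋⁴_{L^K}` programme at fixed `ε = L^{−K}`; `route-QuantumFields-BalabanUVNodes` closes ONLY the CONDITIONAL finite-𝕋⁴ rung `BalabanLadder.UV` — NOT ℝ⁴, NOT OS, NOT the
Yang–Mills mass gap (Clay).  No `sorry`, no `axiom`, no `def`, no `instance`, no `notation`.
Sources (SHAPE only): [III] Thm 1 p.262, (2.1) p.254, (2.4)–(2.8) pp.255–256, (2.10) p.256, (2.12)–(2.13) pp.256–257, (2.18) p.257, (2.25)–(2.28) pp.258–259, (2.34)–(2.41) p.261,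
(3.16)–(3.23) pp.268–270; [15] (6)–(7) p.278, Thm 1 (8)–(9) p.279, (144)–(152) pp.300–301, Prop. 8 p.304; [6] (1.3)–(1.9) p.77; [I] Thm 1 p.259, (0.20) p.256, (1.12) p.262,
(1.20)–(1.22) p.264; [IV] (0.2)–(0.4) p.176; [LF-II] (1.4) p.357.
-/

noncomputable section

open MeasureTheory
open scoped Matrix.Norms.L2Operator

namespace Summit.QuantumFields.YangMills.Theorems.BalabanUVNodesN11K0DoorAtCRLetteredNumerics

open Literature.MathematicalPhysics.QuantumFieldTheory.Balaban1983to89 Node00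
open T4Continuum B14.Eq218Concrete B15DeterminingSets FlowStep FlowStepRuns B12RegularSpaces111 B14RegularSpaces234

variable {F : T4Family} {N : ℕ} [NeZero N] {j c₁₅ : ℕ} {γ c ε₀ ε₂₉ B₃ B₃' a₀ a₁ : ℝ} {θ : Stage13Params F N}

/-! ## §1  The cR-reading letters of the row-`bg` engine AT THE MEMBER (`A₀ = A₀ᶜᶜ¹` unchanged; the slack of `A₀ᶜ = A₀∕8`) -/

section Letters

/-- `A₀ᶜᶜ¹ ≤ A₀∕8` and the two slack inequalities it yields: `8·A₀ᶜᶜ¹ ≤ a₁`, `8·(B₃·A₀ᶜᶜ¹) ≤ a₀`. [cite: Balaban1988Convergent, (2.4) p.255; Balaban1985Variational, (7) p.278, Thm 1 (8) p.279 (bookkeeping)] -/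
theorem eight_mul_A0OfThm1CC1_le {L : ℕ} (hB : 0 ≤ B₃) (hB' : 0 ≤ B₃') (ha₀ : 0 ≤ a₀) (ha₁ : 0 ≤ a₁) :
    8 * A0OfThm1CC1 L B₃ B₃' a₀ a₁ ≤ a₁ ∧ 8 * (B₃ * A0OfThm1CC1 L B₃ B₃' a₀ a₁) ≤ a₀ := by
  have h1 : A0OfThm1CC1 L B₃ B₃' a₀ a₁ ≤ A0OfThm1C B₃ a₀ a₁ := A0OfThm1CC1_le hB hB' ha₀ ha₁
  have h2 : A0OfThm1C B₃ a₀ a₁ = A0OfThm1 B₃ a₀ a₁ / 8 := rfl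
  have h3 := A0OfThm1_le_a₁ hB ha₀ ha₁
  have h4 := mul_A0OfThm1_le_a₀ (a₁ := a₁) hB ha₀
  constructor
  · linarith
  · have := mul_le_mul_of_nonneg_left h1 hB
    rw [h2] at this
    linarith

/-- **(hnum) AT THE MEMBER** for `0 < c ≤ 8` along every windowed run (`γ ≤ ½`): `0 < c·ε_m`, `c·ε_m ≤ a₁`, `B₃·(c·ε_m) ≤ εreg = a₀` (`ε_m ≤ A₀ᶜᶜ¹`, the slack of `A₀ᶜ = A₀∕8`).
[cite: Balaban1988Convergent, (2.4) p.255, (2.10) p.256, (2.12) p.256; Balaban1985Variational, (7) p.278, Thm 1 (8) p.279] -/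
theorem hnum_ccmwCR (hθ : θ = theta13LiveOfNumerics F N
      ({ stage12NumericsOfThm1CCMW F.L j γ ε₀ B₃ B₃' a₀ a₁ with s2 := { sect2NumericsOfThm1C F.L with cR := c } } : Stage12Numerics) ε₂₉
      (zeta316OfRecord F N (stage12NumericsOfThm1CCMW F.L j γ ε₀ B₃ B₃' a₀ a₁).ν (stage12NumericsOfThm1CCMW F.L j γ ε₀ B₃ B₃' a₀ a₁).τ9.M
        (stage12NumericsOfThm1CCMW F.L j γ ε₀ B₃ B₃' a₀ a₁).A₁) (RzOfRecord F N) (ZtOfRecord F N)) (hc0 : 0 < c) (hc8 : c ≤ 8) (hγ : γ ≤ 1 / 2) (hB : 0 ≤ B₃) (hB' : 0 ≤ B₃') (ha₀ : 0 < a₀) (ha₁ : 0 < a₁) :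
    ∀ (p : B12.RunParams) (n : ℕ), n ≤ p.K → Step.InInterval θ.γ n (gOfRecord₁₃ F N θ p) → ∀ m, m ≤ n →
      0 < θ.s2.cR * epsOfRecord θ.ν (gOfRecord₁₃ F N θ p) m ∧ θ.s2.cR * epsOfRecord θ.ν (gOfRecord₁₃ F N θ p) m ≤ a₁ ∧
        B₃ * (θ.s2.cR * epsOfRecord θ.ν (gOfRecord₁₃ F N θ p) m) ≤ θ.ν.εreg := by
  subst hθ
  intro p n _ hw m hm
  have hA0 : 0 ≤ A0OfThm1CC1 F.L B₃ B₃' a₀ a₁ := A0OfThm1CC1_nonneg hB hB' ha₀.le ha₁.le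
  have hApos : 0 < A0OfThm1CC1 F.L B₃ B₃' a₀ a₁ := A0OfThm1CC1_pos hB hB' ha₀ ha₁
  obtain ⟨h8a, h8b⟩ := eight_mul_A0OfThm1CC1_le (L := F.L) hB hB' ha₀.le ha₁.le
  have hle := epsOfRecord_le_A₀_of_p₀_eq_one (numerics7OfThm1CCM F.L j ε₀ B₃ B₃' a₀ a₁) rfl hA0 (hw m hm).1
  have hpos := epsOfRecord_pos (numerics7OfThm1CCM F.L j ε₀ B₃ B₃' a₀ a₁) hApos (hw m hm).1 ((hw m hm).2.trans_lt (hγ.trans_lt (by norm_num)))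
  change 0 < c * epsOfRecord (numerics7OfThm1CCM F.L j ε₀ B₃ B₃' a₀ a₁) _ m ∧ c * epsOfRecord (numerics7OfThm1CCM F.L j ε₀ B₃ B₃' a₀ a₁) _ m ≤ a₁ ∧
    B₃ * (c * epsOfRecord (numerics7OfThm1CCM F.L j ε₀ B₃ B₃' a₀ a₁) _ m) ≤ a₀
  change epsOfRecord (numerics7OfThm1CCM F.L j ε₀ B₃ B₃' a₀ a₁) _ m ≤ A0OfThm1CC1 F.L B₃ B₃' a₀ a₁ at hle
  refine ⟨mul_pos hc0 hpos, ?_, ?_⟩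
  · nlinarith
  · nlinarith [mul_le_mul_of_nonneg_left hle hB]

/-- `θ.ν.εreg ≤ a₀` at the member (it IS `a₀`). [cite: Balaban1985Variational, Thm 1 (8) p.279 (bookkeeping)] -/
theorem εreg_le_ccmwCR (hθ : θ = theta13LiveOfNumerics F N
      ({ stage12NumericsOfThm1CCMW F.L j γ ε₀ B₃ B₃' a₀ a₁ with s2 := { sect2NumericsOfThm1C F.L with cR := c } } : Stage12Numerics) ε₂₉
      (zeta316OfRecord F N (stage12NumericsOfThm1CCMW F.L j γ ε₀ B₃ B₃' a₀ a₁).ν (stage12NumericsOfThm1CCMW F.L j γ ε₀ B₃ B₃' a₀ a₁).τ9.M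
        (stage12NumericsOfThm1CCMW F.L j γ ε₀ B₃ B₃' a₀ a₁).A₁) (RzOfRecord F N) (ZtOfRecord F N)) : θ.ν.εreg ≤ a₀ := by subst hθ; exact le_rfl

/-- The term-constant view `lfOfRecord₁₂` of the member IS that of `θ₁₅ᶜᶜᴹᵂ(j; γ)` (`rfl`; `c`-blind). [cite: Balaban1988Convergent, (2.28) p.259 (bookkeeping)] -/
theorem lfOfRecord₁₂_ccmwCR (hθ : θ = theta13LiveOfNumerics F N
      ({ stage12NumericsOfThm1CCMW F.L j γ ε₀ B₃ B₃' a₀ a₁ with s2 := { sect2NumericsOfThm1C F.L with cR := c } } : Stage12Numerics) ε₂₉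
      (zeta316OfRecord F N (stage12NumericsOfThm1CCMW F.L j γ ε₀ B₃ B₃' a₀ a₁).ν (stage12NumericsOfThm1CCMW F.L j γ ε₀ B₃ B₃' a₀ a₁).τ9.M
        (stage12NumericsOfThm1CCMW F.L j γ ε₀ B₃ B₃' a₀ a₁).A₁) (RzOfRecord F N) (ZtOfRecord F N)) :
    lfOfRecord₁₂ F N θ.toStage12Params = lfOfRecord₁₂ F N (theta13OfThm1CCMW F N j γ ε₀ ε₂₉ B₃ B₃' a₀ a₁).toStage12Params := by subst hθ; rfl

/-- **`p₀ ≤ q₀` AT THE MEMBER** (`1 ≤ 2`; `c`-blind). [cite: Balaban1988Convergent, (2.4) p.255, (2.28) p.259 (bookkeeping)] -/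
theorem hpq_ccmwCR (hθ : θ = theta13LiveOfNumerics F N
      ({ stage12NumericsOfThm1CCMW F.L j γ ε₀ B₃ B₃' a₀ a₁ with s2 := { sect2NumericsOfThm1C F.L with cR := c } } : Stage12Numerics) ε₂₉
      (zeta316OfRecord F N (stage12NumericsOfThm1CCMW F.L j γ ε₀ B₃ B₃' a₀ a₁).ν (stage12NumericsOfThm1CCMW F.L j γ ε₀ B₃ B₃' a₀ a₁).τ9.M
        (stage12NumericsOfThm1CCMW F.L j γ ε₀ B₃ B₃' a₀ a₁).A₁) (RzOfRecord F N) (ZtOfRecord F N)) : θ.ν.p₀ ≤ (lfOfRecord₁₂ F N θ.toStage12Params).q₀ := by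
  rw [lfOfRecord₁₂_ccmwCR hθ]; subst hθ
  exact hpq_theta13OfThm1CCMW (F := F) (N := N) (j := j) (γ := γ) (ε₀ := ε₀) (ε₂₉ := ε₂₉) (B₃ := B₃) (B₃' := B₃') (a₀ := a₀) (a₁ := a₁)

/-- **THE WINDOW LETTERS AT THE MEMBER** (`0 < g_m`, `g_m² ≤ e⁻¹`; `c`-blind — the generated couplings are `θ₁₅ᶜᶜᴹᵂ`'s by `rfl`). [cite: Balaban1987RG1, Thm 1 p.259; Balaban1988Convergent, (2.4) p.255 (bookkeeping)] -/
theorem hg_ccmwCR (hθ : θ = theta13LiveOfNumerics F N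
      ({ stage12NumericsOfThm1CCMW F.L j γ ε₀ B₃ B₃' a₀ a₁ with s2 := { sect2NumericsOfThm1C F.L with cR := c } } : Stage12Numerics) ε₂₉
      (zeta316OfRecord F N (stage12NumericsOfThm1CCMW F.L j γ ε₀ B₃ B₃' a₀ a₁).ν (stage12NumericsOfThm1CCMW F.L j γ ε₀ B₃ B₃' a₀ a₁).τ9.M
        (stage12NumericsOfThm1CCMW F.L j γ ε₀ B₃ B₃' a₀ a₁).A₁) (RzOfRecord F N) (ZtOfRecord F N)) (hγ : γ ≤ 1 / 2) :
    ∀ (p : B12.RunParams) (n : ℕ), n ≤ p.K → Step.InInterval θ.γ n (gOfRecord₁₃ F N θ p) → ∀ m, m ≤ n →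
      0 < gOfRecord₁₃ F N θ p m ∧ gOfRecord₁₃ F N θ p m ^ 2 ≤ Real.exp (-1) := by
  subst hθ
  exact fun _ _ _ hw => window_sq_le_of_inInterval hγ hw

/-- **(C1) NESTED GRIDS AT THE MEMBER** (`R_m = L·t_m`; `c`-blind). [cite: Balaban1988Convergent, (2.5) p.255, p.257] -/
theorem hC1_ccmwCR (hθ : θ = theta13LiveOfNumerics F N
      ({ stage12NumericsOfThm1CCMW F.L j γ ε₀ B₃ B₃' a₀ a₁ with s2 := { sect2NumericsOfThm1C F.L with cR := c } } : Stage12Numerics) ε₂₉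
      (zeta316OfRecord F N (stage12NumericsOfThm1CCMW F.L j γ ε₀ B₃ B₃' a₀ a₁).ν (stage12NumericsOfThm1CCMW F.L j γ ε₀ B₃ B₃' a₀ a₁).τ9.M
        (stage12NumericsOfThm1CCMW F.L j γ ε₀ B₃ B₃' a₀ a₁).A₁) (RzOfRecord F N) (ZtOfRecord F N)) (hγ : γ ≤ 1 / 2) :
    ∀ (p : B12.RunParams) (n : ℕ), n ≤ p.K → Step.InInterval θ.γ n (gOfRecord₁₃ F N θ p) → ∀ m, 1 ≤ m → m ≤ n →
      ∃ t : ℕ, 0 < t ∧ RkOfRecord (F.P p.K).L θ.ν.r (gOfRecord₁₃ F N θ p m) = (F.P p.K).L * t := by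
  subst hθ
  intro p n _ hw m _ hm
  have hL : 2 ≤ (F.P p.K).L := by show 2 ≤ F.L; have := F.hL11; omega
  exact exists_RkOfRecord_eq_mul hL (le_of_eq (rfl : (1 : ℕ) = _)) (one_lt_log_inv_sq_of_le_half (hw m hm).1 ((hw m hm).2.trans hγ))

/-- **(hBα) AT THE MEMBER** for `0 ≤ c ≤ 12` (`bg_numerics_of_letters`: `p₀ ≤ q₀`, `B₃·c·A₀ᶜᶜ¹ ≤ 12∕16 = ¾ = (1 − ¼)·C₀`, the window letters).
[cite: Balaban1988Convergent, (2.4) p.255, (2.28) p.259, (2.34) p.261] -/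
theorem hBα_ccmwCR (hθ : θ = theta13LiveOfNumerics F N
      ({ stage12NumericsOfThm1CCMW F.L j γ ε₀ B₃ B₃' a₀ a₁ with s2 := { sect2NumericsOfThm1C F.L with cR := c } } : Stage12Numerics) ε₂₉
      (zeta316OfRecord F N (stage12NumericsOfThm1CCMW F.L j γ ε₀ B₃ B₃' a₀ a₁).ν (stage12NumericsOfThm1CCMW F.L j γ ε₀ B₃ B₃' a₀ a₁).τ9.M
        (stage12NumericsOfThm1CCMW F.L j γ ε₀ B₃ B₃' a₀ a₁).A₁) (RzOfRecord F N) (ZtOfRecord F N)) (hc0 : 0 ≤ c) (hc12 : c ≤ 12) (hγ : γ ≤ 1 / 2) (hB : 0 ≤ B₃) (hB' : 0 ≤ B₃') (ha₀ : 0 ≤ a₀) (ha₁ : 0 ≤ a₁) :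
    ∀ (p : B12.RunParams) (n : ℕ), n ≤ p.K → Step.InInterval θ.γ n (gOfRecord₁₃ F N θ p) → ∀ m, 1 ≤ m → m ≤ n →
      B₃ * (θ.s2.cR * epsOfRecord θ.ν (gOfRecord₁₃ F N θ p) m) ≤ (1 - θ.s2.βc) * (lfOfRecord₁₂ F N θ.toStage12Params).alpha0 (gOfRecord₁₃ F N θ p m) := by
  have hpq := hpq_ccmwCR hθ
  have hlf := lfOfRecord₁₂_ccmwCR hθ
  have hg := hg_ccmwCR hθ hγ
  subst hθ
  intro p n hn hw
  have hA0 : 0 ≤ A0OfThm1CC1 F.L B₃ B₃' a₀ a₁ := A0OfThm1CC1_nonneg hB hB' ha₀ ha₁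
  have h16 := mul_A0OfThm1CC1_le (L := F.L) hB hB' ha₀ ha₁
  refine Stage13Params.bg_numerics_of_letters _ hpq ?_ ?_ p n (hg p n hn hw)
  · change 0 ≤ B₃ * c * A0OfThm1CC1 F.L B₃ B₃' a₀ a₁
    positivity
  · rw [hlf, lfOfRecord₁₂_theta13OfThm1CCMW]
    change B₃ * c * A0OfThm1CC1 F.L B₃ B₃' a₀ a₁ ≤ (1 - 1 / 4) * _
    norm_num [lfConstsOfFamily, lfConstsOfRecord₁₂]
    nlinarith

/-- **★ THE I-FAMILY RADIUS LETTER (htI) AT THE MEMBER** for `0 ≤ c ≤ 192` (`gaugeLetter_of_numerics`: `B₃′·c·A₀ᶜᶜ¹ ≤ 1 ≤ c_B·C₀`, `B₃′·A₀ᶜᶜ¹ ≤ 1∕192`).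
[cite: Balaban1987RG1, (1.12) p.262; Balaban1988Convergent, (2.4) p.255, (2.28) p.259] -/
theorem htI_ccmwCR (hθ : θ = theta13LiveOfNumerics F N
      ({ stage12NumericsOfThm1CCMW F.L j γ ε₀ B₃ B₃' a₀ a₁ with s2 := { sect2NumericsOfThm1C F.L with cR := c } } : Stage12Numerics) ε₂₉
      (zeta316OfRecord F N (stage12NumericsOfThm1CCMW F.L j γ ε₀ B₃ B₃' a₀ a₁).ν (stage12NumericsOfThm1CCMW F.L j γ ε₀ B₃ B₃' a₀ a₁).τ9.M
        (stage12NumericsOfThm1CCMW F.L j γ ε₀ B₃ B₃' a₀ a₁).A₁) (RzOfRecord F N) (ZtOfRecord F N)) (hc0 : 0 ≤ c) (hc : c ≤ 192) (hγ : γ ≤ 1 / 2) (hB : 0 ≤ B₃) (hB' : 0 ≤ B₃') (ha₀ : 0 ≤ a₀) (ha₁ : 0 ≤ a₁) :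
    ∀ (p : B12.RunParams) (n : ℕ), n ≤ p.K → Step.InInterval θ.γ n (gOfRecord₁₃ F N θ p) → ∀ m, 1 ≤ m → m ≤ n →
      B₃' * (θ.s2.cR * epsOfRecord θ.ν (gOfRecord₁₃ F N θ p) m) ≤ θ.s2.cB * (lfOfRecord₁₂ F N θ.toStage12Params).alpha0 (gOfRecord₁₃ F N θ p m) := by
  have hpq := hpq_ccmwCR hθ
  have hlf := lfOfRecord₁₂_ccmwCR hθ
  have hg := hg_ccmwCR hθ hγ
  subst hθ
  intro p n hn hw
  have hA0 : 0 ≤ A0OfThm1CC1 F.L B₃ B₃' a₀ a₁ := A0OfThm1CC1_nonneg hB hB' ha₀ ha₁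
  have h192 := gauge_mul_A0OfThm1CC1_le (L := F.L) F.hL.2.le hB hB' ha₀ ha₁
  have hL1 : (1 : ℝ) ≤ F.L := by exact_mod_cast F.hL.2.le
  refine gaugeLetter_of_numerics _ _ (fun m _ hm => hg p n hn hw m hm) hpq ?_ ?_
  · change 0 ≤ B₃' * c * A0OfThm1CC1 F.L B₃ B₃' a₀ a₁
    positivity
  · rw [hlf, lfOfRecord₁₂_theta13OfThm1CCMW]
    change B₃' * c * A0OfThm1CC1 F.L B₃ B₃' a₀ a₁ ≤ (6 * (F.L : ℝ) + 1) * _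
    norm_num [lfConstsOfFamily, lfConstsOfRecord₁₂]
    nlinarith

/-- **★ THE MS-FAMILY RADIUS LETTER (htMS) AT THE MEMBER** for `0 ≤ c ≤ 192` (`B₃′·c·A₀ᶜᶜ¹ ≤ 1 ≤ 7 = B·C·M_r·C₀`). [cite: Balaban1988Convergent, (2.38) p.261, (2.4) p.255, (2.28) p.259] -/
theorem htMS_ccmwCR (hθ : θ = theta13LiveOfNumerics F N
      ({ stage12NumericsOfThm1CCMW F.L j γ ε₀ B₃ B₃' a₀ a₁ with s2 := { sect2NumericsOfThm1C F.L with cR := c } } : Stage12Numerics) ε₂₉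
      (zeta316OfRecord F N (stage12NumericsOfThm1CCMW F.L j γ ε₀ B₃ B₃' a₀ a₁).ν (stage12NumericsOfThm1CCMW F.L j γ ε₀ B₃ B₃' a₀ a₁).τ9.M
        (stage12NumericsOfThm1CCMW F.L j γ ε₀ B₃ B₃' a₀ a₁).A₁) (RzOfRecord F N) (ZtOfRecord F N)) (hc0 : 0 ≤ c) (hc : c ≤ 192) (hγ : γ ≤ 1 / 2) (hB : 0 ≤ B₃) (hB' : 0 ≤ B₃') (ha₀ : 0 ≤ a₀) (ha₁ : 0 ≤ a₁) :
    ∀ (p : B12.RunParams) (n : ℕ), n ≤ p.K → Step.InInterval θ.γ n (gOfRecord₁₃ F N θ p) → ∀ m, 1 ≤ m → m ≤ n →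
      B₃' * (θ.s2.cR * epsOfRecord θ.ν (gOfRecord₁₃ F N θ p) m) ≤ θ.s2.B * θ.s2.C * θ.s2.Mr * (lfOfRecord₁₂ F N θ.toStage12Params).alpha0 (gOfRecord₁₃ F N θ p m) := by
  have hpq := hpq_ccmwCR hθ
  have hlf := lfOfRecord₁₂_ccmwCR hθ
  have hg := hg_ccmwCR hθ hγ
  subst hθ
  intro p n hn hw
  have hA0 : 0 ≤ A0OfThm1CC1 F.L B₃ B₃' a₀ a₁ := A0OfThm1CC1_nonneg hB hB' ha₀ ha₁
  have h192 := gauge_mul_A0OfThm1CC1_le (L := F.L) F.hL.2.le hB hB' ha₀ ha₁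
  refine gaugeLetter_of_numerics _ _ (fun m _ hm => hg p n hn hw m hm) hpq ?_ ?_
  · change 0 ≤ B₃' * c * A0OfThm1CC1 F.L B₃ B₃' a₀ a₁
    positivity
  · rw [hlf, lfOfRecord₁₂_theta13OfThm1CCMW]
    change B₃' * c * A0OfThm1CC1 F.L B₃ B₃' a₀ a₁ ≤ 7 * 1 * 1 * _
    norm_num [lfConstsOfFamily, lfConstsOfRecord₁₂]
    nlinarith

/-- **(hcomp) AT THE MEMBER FROM (hcomp) AT `θ₁₅ᶜᶜᴹᵂ`** (`0 ≤ c`; the thresholds `ε_m` are `c`-blind — `rfl` — and (hcomp) is homogeneous in `cR`).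
[cite: Balaban1988Convergent, (2.4) p.255, (2.7)–(2.8) pp.255–256 (bookkeeping)] -/
theorem hcomp_ccmwCR_of_ccmw (hθ : θ = theta13LiveOfNumerics F N
      ({ stage12NumericsOfThm1CCMW F.L j γ ε₀ B₃ B₃' a₀ a₁ with s2 := { sect2NumericsOfThm1C F.L with cR := c } } : Stage12Numerics) ε₂₉
      (zeta316OfRecord F N (stage12NumericsOfThm1CCMW F.L j γ ε₀ B₃ B₃' a₀ a₁).ν (stage12NumericsOfThm1CCMW F.L j γ ε₀ B₃ B₃' a₀ a₁).τ9.M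
        (stage12NumericsOfThm1CCMW F.L j γ ε₀ B₃ B₃' a₀ a₁).A₁) (RzOfRecord F N) (ZtOfRecord F N)) (hc0 : 0 ≤ c)
    (H : ∀ (p : B12.RunParams) (n : ℕ), n ≤ p.K → Step.InInterval (theta13OfThm1CCMW F N j γ ε₀ ε₂₉ B₃ B₃' a₀ a₁).γ n (gOfRecord₁₃ F N (theta13OfThm1CCMW F N j γ ε₀ ε₂₉ B₃ B₃' a₀ a₁) p) → ∀ m, m < n →
      (theta13OfThm1CCMW F N j γ ε₀ ε₂₉ B₃ B₃' a₀ a₁).s2.cR * epsOfRecord (theta13OfThm1CCMW F N j γ ε₀ ε₂₉ B₃ B₃' a₀ a₁).ν (gOfRecord₁₃ F N (theta13OfThm1CCMW F N j γ ε₀ ε₂₉ B₃ B₃' a₀ a₁) p) m ≤ 2 * ((theta13OfThm1CCMW F N j γ ε₀ ε₂₉ B₃ B₃' a₀ a₁).s2.cR * epsOfRecord (theta13OfThm1CCMW F N j γ ε₀ ε₂₉ B₃ B₃' a₀ a₁).ν (gOfRecord₁₃ F N (theta13OfThm1CCMW F N j γ ε₀ ε₂₉ B₃ B₃' a₀ a₁)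 p) (m + 1))) :
    ∀ (p : B12.RunParams) (n : ℕ), n ≤ p.K → Step.InInterval θ.γ n (gOfRecord₁₃ F N θ p) → ∀ m, m < n →
      θ.s2.cR * epsOfRecord θ.ν (gOfRecord₁₃ F N θ p) m ≤ 2 * (θ.s2.cR * epsOfRecord θ.ν (gOfRecord₁₃ F N θ p) (m + 1)) := by
  subst hθ
  intro p n hn hw m hm
  have h := H p n hn hw m hm
  rw [theta13OfThm1CCMW_cR, one_mul, one_mul] at h
  change c * epsOfRecord (theta13OfThm1CCMW F N j γ ε₀ ε₂₉ B₃ B₃' a₀ a₁).ν (gOfRecord₁₃ F N (theta13OfThm1CCMW F N j γ ε₀ ε₂₉ B₃ B₃' a₀ a₁) p) m ≤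
    2 * (c * epsOfRecord (theta13OfThm1CCMW F N j γ ε₀ ε₂₉ B₃ B₃' a₀ a₁).ν (gOfRecord₁₃ F N (theta13OfThm1CCMW F N j γ ε₀ ε₂₉ B₃ B₃' a₀ a₁) p) (m + 1))
  nlinarith [mul_le_mul_of_nonneg_left h hc0]

/-- **(hcompRev) AT THE MEMBER FROM (hcompRev) AT `θ₁₅ᶜᶜᴹᵂ`** (`0 ≤ c`). [cite: Balaban1988Convergent, (2.4) p.255, (2.7)–(2.8) pp.255–256 (bookkeeping)] -/
theorem hcompRev_ccmwCR_of_ccmw (hθ : θ = theta13LiveOfNumerics F N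
      ({ stage12NumericsOfThm1CCMW F.L j γ ε₀ B₃ B₃' a₀ a₁ with s2 := { sect2NumericsOfThm1C F.L with cR := c } } : Stage12Numerics) ε₂₉
      (zeta316OfRecord F N (stage12NumericsOfThm1CCMW F.L j γ ε₀ B₃ B₃' a₀ a₁).ν (stage12NumericsOfThm1CCMW F.L j γ ε₀ B₃ B₃' a₀ a₁).τ9.M
        (stage12NumericsOfThm1CCMW F.L j γ ε₀ B₃ B₃' a₀ a₁).A₁) (RzOfRecord F N) (ZtOfRecord F N)) (hc0 : 0 ≤ c)
    (H : ∀ (p : B12.RunParams) (n : ℕ), n ≤ p.K → Step.InInterval (theta13OfThm1CCMW F N j γ ε₀ ε₂₉ B₃ B₃' a₀ a₁).γ n (gOfRecord₁₃ F N (theta13OfThm1CCMW F N j γ ε₀ ε₂₉ B₃ B₃' a₀ a₁) p) → ∀ m, m < n →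
      (theta13OfThm1CCMW F N j γ ε₀ ε₂₉ B₃ B₃' a₀ a₁).s2.cR * epsOfRecord (theta13OfThm1CCMW F N j γ ε₀ ε₂₉ B₃ B₃' a₀ a₁).ν (gOfRecord₁₃ F N (theta13OfThm1CCMW F N j γ ε₀ ε₂₉ B₃ B₃' a₀ a₁) p) (m + 1) ≤ 2 * ((theta13OfThm1CCMW F N j γ ε₀ ε₂₉ B₃ B₃' a₀ a₁).s2.cR * epsOfRecord (theta13OfThm1CCMW F N j γ ε₀ ε₂₉ B₃ B₃' a₀ a₁).ν (gOfRecord₁₃ F N (theta13OfThm1CCMW F N j γ ε₀ ε₂₉ B₃ B₃' a₀ a₁) p) m)) :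
    ∀ (p : B12.RunParams) (n : ℕ), n ≤ p.K → Step.InInterval θ.γ n (gOfRecord₁₃ F N θ p) → ∀ m, m < n →
      θ.s2.cR * epsOfRecord θ.ν (gOfRecord₁₃ F N θ p) (m + 1) ≤ 2 * (θ.s2.cR * epsOfRecord θ.ν (gOfRecord₁₃ F N θ p) m) := by
  subst hθ
  intro p n hn hw m hm
  have h := H p n hn hw m hm
  rw [theta13OfThm1CCMW_cR, one_mul, one_mul] at h
  change c * epsOfRecord (theta13OfThm1CCMW F N j γ ε₀ ε₂₉ B₃ B₃' a₀ a₁).ν (gOfRecord₁₃ F N (theta13OfThm1CCMW F N j γ ε₀ ε₂₉ B₃ B₃' a₀ a₁) p) (m + 1) ≤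
    2 * (c * epsOfRecord (theta13OfThm1CCMW F N j γ ε₀ ε₂₉ B₃ B₃' a₀ a₁).ν (gOfRecord₁₃ F N (theta13OfThm1CCMW F N j γ ε₀ ε₂₉ B₃ B₃' a₀ a₁) p) m)
  nlinarith [mul_le_mul_of_nonneg_left h hc0]

/-- **★ (hcomp) ∧ (hcompRev) AT THE MEMBER FROM THE SIGN-FREE WINDOWED β-BOX OF `betaOfRecord₁₃ F N θ₁₅ᶜᶜᴹᵂ(j; γ)`** — Dʷ `hcompBoth_theta13OfThm1CCMW_of_betaBoxSignFree` ∘ the rescaling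
(the β of record is `c`-blind: the box IS the member's). [cite: Balaban1987RG1, (0.20) p.256, (1.20)–(1.22) p.264; Balaban1988Convergent, (2.6)–(2.8) pp.255–256] -/
theorem hcompBoth_ccmwCR_of_betaBoxSignFree (hθ : θ = theta13LiveOfNumerics F N
      ({ stage12NumericsOfThm1CCMW F.L j γ ε₀ B₃ B₃' a₀ a₁ with s2 := { sect2NumericsOfThm1C F.L with cR := c } } : Stage12Numerics) ε₂₉
      (zeta316OfRecord F N (stage12NumericsOfThm1CCMW F.L j γ ε₀ B₃ B₃' a₀ a₁).ν (stage12NumericsOfThm1CCMW F.L j γ ε₀ B₃ B₃' a₀ a₁).τ9.M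
        (stage12NumericsOfThm1CCMW F.L j γ ε₀ B₃ B₃' a₀ a₁).A₁) (RzOfRecord F N) (ZtOfRecord F N)) (hc0 : 0 ≤ c) (hγ : γ ≤ 1 / 2) (hB : 0 ≤ B₃) (hB' : 0 ≤ B₃') (ha₀ : 0 ≤ a₀) (ha₁ : 0 ≤ a₁)
    {bl β' : ℝ} (hbox : BetaLowerH bl γ (betaOfRecord₁₃ F N (theta13OfThm1CCMW F N j γ ε₀ ε₂₉ B₃ B₃' a₀ a₁)))
    (hbox' : BetaUpperH β' γ (betaOfRecord₁₃ F N (theta13OfThm1CCMW F N j γ ε₀ ε₂₉ B₃ B₃' a₀ a₁))) (hl : -bl * γ ^ 2 ≤ 3) (hβ' : β' * γ ^ 2 ≤ 3 / 4) :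
    (∀ (p : B12.RunParams) (n : ℕ), n ≤ p.K → Step.InInterval θ.γ n (gOfRecord₁₃ F N θ p) → ∀ m, m < n →
      θ.s2.cR * epsOfRecord θ.ν (gOfRecord₁₃ F N θ p) m ≤ 2 * (θ.s2.cR * epsOfRecord θ.ν (gOfRecord₁₃ F N θ p) (m + 1))) ∧
    (∀ (p : B12.RunParams) (n : ℕ), n ≤ p.K → Step.InInterval θ.γ n (gOfRecord₁₃ F N θ p) → ∀ m, m < n →
      θ.s2.cR * epsOfRecord θ.ν (gOfRecord₁₃ F N θ p) (m + 1) ≤ 2 * (θ.s2.cR * epsOfRecord θ.ν (gOfRecord₁₃ F N θ p) m)) :=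
  have H := hcompBoth_theta13OfThm1CCMW_of_betaBoxSignFree (F := F) (N := N) (j := j) (ε₀ := ε₀) (ε₂₉ := ε₂₉) hγ hB hB' ha₀ ha₁ hbox hbox' hl hβ'
  ⟨hcomp_ccmwCR_of_ccmw hθ hc0 H.1, hcompRev_ccmwCR_of_ccmw hθ hc0 H.2⟩

end Letters

/-! ## §2  ★★★ The (7)-guarded separated row P11 at the Co carrier AT THE MEMBER, on every family -/

section BgRow

/-- **★★★ THE (7)-GUARDED SEPARATED ROW P11 AT THE Co CARRIER AT THE cR-LETTERED MEMBER FROM `0 < γ ≤ ½`, (8), THE R GAUGE SENTENCE AND (hcomp) ∧ (hcompRev), ON EVERY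
FAMILY, for `0 < c ≤ 8`** — dag-n21-c's Eʷ-allTorus §3 (`bgSepCoPAt_theta13OfThm1CCMW_of_thm1GaugeR_of_hcomp_allTorus`) RE-RUN AT THE MEMBER through the θ-generic engine
`Stage13Params.bgAtDatumCoP_of_thm1RegSepCoP7M_of_thm1GaugeR_allTorus` with §1's letters (statement = Eʷ's with `θ₁₅ᶜᶜᴹᵂ ↦ θ`).  CONDITIONAL; nothing of Bałaban asserted.
[cite: Balaban1985Variational, (6)–(7) p.278, Thm 1 (8)–(9) p.279, (144)–(152) pp.300–301, Prop. 8 p.304; Balaban1985RegularSpaces, (1.3)–(1.9) p.77; Balaban1988Convergent, Thm 1 p.262, (2.1) p.254, (2.4)–(2.8) pp.255–256, (2.10) p.256, (2.12)–(2.13) pp.256–257, (2.18) p.257, (2.25)–(2.28) pp.258–259; Balaban1987RG1, Thm 1 p.259, (1.12) p.262] -/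
theorem bgSepCoPAt_ccmwCR_of_thm1GaugeR_of_hcomp_allTorus (hθ : θ = theta13LiveOfNumerics F N
      ({ stage12NumericsOfThm1CCMW F.L j γ ε₀ B₃ B₃' a₀ a₁ with s2 := { sect2NumericsOfThm1C F.L with cR := c } } : Stage12Numerics) ε₂₉
      (zeta316OfRecord F N (stage12NumericsOfThm1CCMW F.L j γ ε₀ B₃ B₃' a₀ a₁).ν (stage12NumericsOfThm1CCMW F.L j γ ε₀ B₃ B₃' a₀ a₁).τ9.M
        (stage12NumericsOfThm1CCMW F.L j γ ε₀ B₃ B₃' a₀ a₁).A₁) (RzOfRecord F N) (ZtOfRecord F N))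
    (hc0 : 0 < c) (hc8 : c ≤ 8) (hγ0 : 0 < γ) (hγ : γ ≤ 1 / 2) (hε : 0 < ε₀) (hε' : 0 < ε₂₉) (hB : 0 ≤ B₃) (hB' : 0 ≤ B₃') (ha₀ : 0 < a₀) (ha₁ : 0 < a₁)
    (h15 : VariationalThm1RegSepCoP7M F N B₃ a₀ a₁) (hc₁₅ : c₁₅ ≤ F.L ^ j) (h15G : VariationalThm1GaugeRegSepCoP7MR F N (F.L ^ j) c₁₅ B₃ B₃' a₀ a₁)
    (hcomp : ∀ (p : B12.RunParams) (n : ℕ), n ≤ p.K → Step.InInterval θ.γ n (gOfRecord₁₃ F N θ p) → ∀ m, m < n →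
      θ.s2.cR * epsOfRecord θ.ν (gOfRecord₁₃ F N θ p) m ≤ 2 * (θ.s2.cR * epsOfRecord θ.ν (gOfRecord₁₃ F N θ p) (m + 1)))
    (hcompRev : ∀ (p : B12.RunParams) (n : ℕ), n ≤ p.K → Step.InInterval θ.γ n (gOfRecord₁₃ F N θ p) → ∀ m, m < n →
      θ.s2.cR * epsOfRecord θ.ν (gOfRecord₁₃ F N θ p) (m + 1) ≤ 2 * (θ.s2.cR * epsOfRecord θ.ν (gOfRecord₁₃ F N θ p) m)) :
    ∀ (p : B12.RunParams) (n : ℕ), n ≤ p.K → Step.InInterval θ.γ n (gOfRecord₁₃ F N θ p) → PartCompat₁₃ F N θ p n →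
      ∀ s : SeqOfRecord F θ.ν θ.τ9.M (gOfRecord₁₃ F N θ p) p.K n, Sect2.SeqSeparated θ.ν.M₁ s →
      ∀ W : MSField (F.P p.K) (SU N), W ∈ suppOfRecord₁₃P F N θ p n s →
      Sect2.DataSmall7PTop (avOfRecord F N p.K) s.Ω (suppDomOfRecord F θ.ν p.K s.Ω) n (fun j' => θ.s2.cR * epsOfRecord θ.ν (gOfRecord₁₃ F N θ p) j') W →
      ∀ j', 1 ≤ j' → j' ≤ n → ∀ X : (Sect2.domSys (F.P p.K) θ.τ9.M j').Dom,
      (Sect2.domSites (F.P p.K) θ.τ9.M j' X ⊆ s.Λ j' →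
        Sect2.ofBackgroundC (settingOfRecord₁₃ F N θ p).ι (UbgOfRecord₁₃CoP F N θ p n s W) ∈
          Sect2.spaceI (settingOfRecord₁₃ F N θ p) (θ.Rz p.K) θ.τ9.M j' (Sect2.domSites (F.P p.K) θ.τ9.M j' X)
            ((settingOfRecord₁₃ F N θ p).lf.alpha0 ((settingOfRecord₁₃ F N θ p).flow.g j')) ((settingOfRecord₁₃ F N θ p).lf.alpha1 ((settingOfRecord₁₃ F N θ p).flow.g j'))) ∧
      (Sect2.admB (F.P p.K) θ.ν θ.τ9.M (gOfRecord₁₃ F N θ p) s.Ω s.Λ j' (Sect2.domSites (F.P p.K) θ.τ9.M j' X) = true →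
        Sect2.ofBackgroundC (settingOfRecord₁₃ F N θ p).ι (UbgOfRecord₁₃CoP F N θ p n s W) ∈
          Sect2.spaceMS (settingOfRecord₁₃ F N θ p) (θ.Rz p.K) θ.τ9.M j' (Sect2.domSites (F.P p.K) θ.τ9.M j' X) s.Ω) := by
  have hnum := hnum_ccmwCR hθ hc0 hc8 hγ hB hB' ha₀ ha₁
  have hεreg := εreg_le_ccmwCR hθ
  have hBα := hBα_ccmwCR hθ hc0.le (by linarith) hγ hB hB' ha₀.le ha₁.le
  have htI := htI_ccmwCR hθ hc0.le (by linarith) hγ hB hB' ha₀.le ha₁.le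
  have htMS := htMS_ccmwCR hθ hc0.le (by linarith) hγ hB hB' ha₀.le ha₁.le
  have hC1 := hC1_ccmwCR hθ hγ
  subst hθ
  have hγ1 : γ < 1 := hγ.trans_lt (by norm_num)
  have hpos : ({ stage12NumericsOfThm1CCMW F.L j γ ε₀ B₃ B₃' a₀ a₁ with s2 := { sect2NumericsOfThm1C F.L with cR := c } } : Stage12Numerics).Pos := by
    obtain ⟨h1, h2, h3, h4, h5, h6, -, h8, h9⟩ := stage12NumericsOfThm1CCMW_pos (j := j) F.hL.2.le hγ0 hγ1 hε hB hB' ha₀ ha₁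
    exact ⟨h1, h2, h3, h4, h5, h6, hc0, h8, h9⟩
  have hadm := (admissible_theta13OfNumerics
    (n := ({ stage12NumericsOfThm1CCMW F.L j γ ε₀ B₃ B₃' a₀ a₁ with s2 := { sect2NumericsOfThm1C F.L with cR := c } } : Stage12Numerics)) F N
    (zeta316OfRecord F N (stage12NumericsOfThm1CCMW F.L j γ ε₀ B₃ B₃' a₀ a₁).ν (stage12NumericsOfThm1CCMW F.L j γ ε₀ B₃ B₃' a₀ a₁).τ9.M
      (stage12NumericsOfThm1CCMW F.L j γ ε₀ B₃ B₃' a₀ a₁).A₁) (RzOfRecord F N) (ZtOfRecord F N) hpos hε').liveRepin₁₃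
  intro p n hn hw hpc s hsep W _ h7
  cases n with
  | zero => intro j' h1 hj'; exfalso; omega
  | succ n =>
    rw [UbgOfRecord₁₃CoP_succ]
    exact Stage13Params.bgAtDatumCoP_of_thm1RegSepCoP7M_of_thm1GaugeR_allTorus _ hadm rfl
      (show 0 < F.L ^ j from pow_pos (by have := F.hL11; omega) _) (show c₁₅ ≤ F.L ^ j from hc₁₅) h15 h15G hnum hεreg
      hcomp hcompRev hBα htI htMS hC1 ⟨j, rfl⟩ p (n + 1) hn hw hpc s hsep (show 0 < F.L ^ j from pow_pos (by have := F.hL11; omega) _) W h7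

end BgRow

/-! ## §3  ★★★★ K0⁷'s door provisos at the member from Part 14 §0c's hypotheses VERBATIM (plus `0 < c ≤ 8`) -/

section Door

/-- **★★★ `Provisos₁₃SepCoP` AT THE MEMBER FROM `0 < γ ≤ ½`, (8), THE R GAUGE SENTENCE AND (hcomp) ∧ (hcompRev), ON EVERY FAMILY** — node00-def-K0a's generic socket
`provisos₁₃SepCoP_theta13LiveOfNumerics_of_bgSepCoP` ∘ §2 (`hM := ⟨j, rfl⟩`, `hM₁ := dvd_refl`).  CONDITIONAL; nothing of Bałaban asserted.
[cite: Balaban1985Variational, Thm 1 (8)–(9) p.279, (152) p.301; Balaban1988Convergent, Thm 1 p.262, (2.7) p.255, (2.12) p.256, (2.28) p.259, (3.16)–(3.22) pp.268–269; Balaban1985RegularSpaces, (1.3)–(1.9) p.77] -/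
theorem provisos₁₃SepCoP_ccmwCR_of_thm1GaugeR_of_hcomp_allTorus (hθ : θ = theta13LiveOfNumerics F N
      ({ stage12NumericsOfThm1CCMW F.L j γ ε₀ B₃ B₃' a₀ a₁ with s2 := { sect2NumericsOfThm1C F.L with cR := c } } : Stage12Numerics) ε₂₉
      (zeta316OfRecord F N (stage12NumericsOfThm1CCMW F.L j γ ε₀ B₃ B₃' a₀ a₁).ν (stage12NumericsOfThm1CCMW F.L j γ ε₀ B₃ B₃' a₀ a₁).τ9.M
        (stage12NumericsOfThm1CCMW F.L j γ ε₀ B₃ B₃' a₀ a₁).A₁) (RzOfRecord F N) (ZtOfRecord F N))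
    (hc0 : 0 < c) (hc8 : c ≤ 8) (hγ0 : 0 < γ) (hγ : γ ≤ 1 / 2) (hε : 0 < ε₀) (hε' : 0 < ε₂₉) (hB : 0 ≤ B₃) (hB' : 0 ≤ B₃') (ha₀ : 0 < a₀) (ha₁ : 0 < a₁)
    (h15 : VariationalThm1RegSepCoP7M F N B₃ a₀ a₁) (hc₁₅ : c₁₅ ≤ F.L ^ j) (h15G : VariationalThm1GaugeRegSepCoP7MR F N (F.L ^ j) c₁₅ B₃ B₃' a₀ a₁)
    (hcomp : ∀ (p : B12.RunParams) (n : ℕ), n ≤ p.K → Step.InInterval θ.γ n (gOfRecord₁₃ F N θ p) → ∀ m, m < n →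
      θ.s2.cR * epsOfRecord θ.ν (gOfRecord₁₃ F N θ p) m ≤ 2 * (θ.s2.cR * epsOfRecord θ.ν (gOfRecord₁₃ F N θ p) (m + 1)))
    (hcompRev : ∀ (p : B12.RunParams) (n : ℕ), n ≤ p.K → Step.InInterval θ.γ n (gOfRecord₁₃ F N θ p) → ∀ m, m < n →
      θ.s2.cR * epsOfRecord θ.ν (gOfRecord₁₃ F N θ p) (m + 1) ≤ 2 * (θ.s2.cR * epsOfRecord θ.ν (gOfRecord₁₃ F N θ p) m)) :
    θ.Provisos₁₃SepCoP F N := by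
  have hbg := bgSepCoPAt_ccmwCR_of_thm1GaugeR_of_hcomp_allTorus hθ hc0 hc8 hγ0 hγ hε hε' hB hB' ha₀ ha₁ h15 hc₁₅ h15G hcomp hcompRev
  subst hθ
  exact provisos₁₃SepCoP_theta13LiveOfNumerics_of_bgSepCoP (F := F) (N := N)
    (n := ({ stage12NumericsOfThm1CCMW F.L j γ ε₀ B₃ B₃' a₀ a₁ with s2 := { sect2NumericsOfThm1C F.L with cR := c } } : Stage12Numerics))
    (ε₂₉ := ε₂₉) (hM := ⟨j, rfl⟩) (hM₁ := dvd_refl _) (hbgSepCoP := hbg)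

/-- **★★★★ K0⁷'s DOOR PROVISOS AT THE HISTORY-BLIND DOOR OVER THE CURED cR-LETTERED MEMBER, FROM dag-n24-c PART 14 §0c's HYPOTHESES VERBATIM** (`0 < γ ≤ ½`, the six signs,
(8) `VariationalThm1RegSepCoP7M F N B₃ a₀ a₁`, the floor `c₁₅ ≤ L^j`, [15] Sect. F's R (9)-step `Gauge9RegSepTopStepR … (F.L ^ j) c₁₅ B₃ B₃' a₀ a₁`, the SIGN-FREE windowed β-box
`BetaLowerH bₗ γ ∕ BetaUpperH β′ γ` OF `betaOfRecord₁₃ F N θ₁₅ᶜᶜᴹᵂ(j; γ)` with `−bₗ·γ² ≤ 3`, `β′·γ² ≤ ¾`) **PLUS ONLY `0 < c ≤ 8`** — the K0 side of the cR re-pin is FREE.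
CONDITIONAL on the displayed sentences (K0⁷'s stub territory); nothing of Bałaban asserted.
[cite: Balaban1985Variational, Thm 1 (8)–(9) p.279, (144)–(152) pp.300–301, Prop. 8 p.304; Balaban1988Convergent, Thm 1 p.262, (2.6)–(2.8) pp.255–256, (2.10) p.256, (2.21) p.258, (3.16)–(3.23) pp.268–270; Balaban1987RG1, Thm 1 p.259, (0.20) p.256, (1.20)–(1.22) p.264, §1 p.264; Balaban1989LargeFieldI, (0.2)–(0.4) p.176; Balaban1989LargeFieldII, (1.4) p.357] -/
theorem provisos₁₃SepCoPH_door_ccmwCR_of_gauge9TopStepR_of_betaBoxSignFree_allTorus (hθ : θ = theta13LiveOfNumerics F N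
      ({ stage12NumericsOfThm1CCMW F.L j γ ε₀ B₃ B₃' a₀ a₁ with s2 := { sect2NumericsOfThm1C F.L with cR := c } } : Stage12Numerics) ε₂₉
      (zeta316OfRecord F N (stage12NumericsOfThm1CCMW F.L j γ ε₀ B₃ B₃' a₀ a₁).ν (stage12NumericsOfThm1CCMW F.L j γ ε₀ B₃ B₃' a₀ a₁).τ9.M
        (stage12NumericsOfThm1CCMW F.L j γ ε₀ B₃ B₃' a₀ a₁).A₁) (RzOfRecord F N) (ZtOfRecord F N))
    (hc0 : 0 < c) (hc8 : c ≤ 8) (hγ0 : 0 < γ) (hγ : γ ≤ 1 / 2) (hε : 0 < ε₀) (hε' : 0 < ε₂₉) (hB : 0 ≤ B₃) (hB' : 0 ≤ B₃') (ha₀ : 0 < a₀) (ha₁ : 0 < a₁)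
    (h15 : VariationalThm1RegSepCoP7M F N B₃ a₀ a₁) (hc₁₅ : c₁₅ ≤ F.L ^ j)
    (h9 : Gauge9RegSepTopStepR F N (fun ν K Ω => suppDomOfRecord F ν K Ω) (F.L ^ j) c₁₅ B₃ B₃' a₀ a₁)
    {bl β' : ℝ} (hbox : BetaLowerH bl γ (betaOfRecord₁₃ F N (theta13OfThm1CCMW F N j γ ε₀ ε₂₉ B₃ B₃' a₀ a₁)))
    (hbox' : BetaUpperH β' γ (betaOfRecord₁₃ F N (theta13OfThm1CCMW F N j γ ε₀ ε₂₉ B₃ B₃' a₀ a₁))) (hl : -bl * γ ^ 2 ≤ 3) (hβ' : β' * γ ^ 2 ≤ 3 / 4) :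
    (Stage13HParams.ofHistoryBlind F N ⟨θ, ZrOfRecord₁₃ F N θ⟩).Provisos₁₃SepCoPH F N :=
  have H := hcompBoth_ccmwCR_of_betaBoxSignFree hθ hc0.le hγ hB hB' ha₀.le ha₁.le hbox hbox' hl hβ'
  (provisos₁₃SepCoP_ccmwCR_of_thm1GaugeR_of_hcomp_allTorus hθ hc0 hc8 hγ0 hγ hε hε' hB hB' ha₀ ha₁ h15 hc₁₅
    (variationalThm1GaugeRegSepCoP7MR_of_gauge9TopStepR h9) H.1 H.2).ofCured.ofHistoryBlind

end Door

end Summit.QuantumFields.YangMills.Theorems.BalabanUVNodesN11K0DoorAtCRLetteredNumerics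

end
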